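import Summits.ResolutionOfSingularities.ResolutionOfSingularities.Theorems.PurelyInseparableDim4E2OfCJSModelRow
import Summits.ResolutionOfSingularities.ResolutionOfSingularities.Theorems.PurelyInseparableDim4E2OfCJSStrictTransform
import Literature.AlgebraicGeometry.Resolution.PointCentrePermissible
import Literature.AlgebraicGeometry.Resolution.CartierDivisorControlledTransform
import Literature.AlgebraicGeometry.Resolution.RegularBlowup
import HarnessLib

/-!
# F4-I(3,3) from CJS — SECOND ROUTE (B) for row (M): `E2OfCJS.TowerInvariants` HOLDS along the concrete tower
# (cell `res-dim4-pi`; seat p-7 g2; tower res-dim4-p-2 g2 `…E2OfCJSModel`; model lemmas res-dim4-p-11 g2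
# `…E2OfCJSStrictTransform`; holder res-dim4-p-2 g2; K res-dim4-p-9 g2)

[OURS · counted 0 · AI work weaker than expert review.]  NOTHING here proves `NoIsolatedTrap 3 3` unconditionally or
resolution of singularities in dimension ≥ 4 / characteristic `p`.

`TowerInvariants` (p668106, `…E2OfCJSModelRow`) asks, along res-dim4-p-2 g2's tower `GStage.tower c hc` of point
blow-ups of `𝔸⁵_K` reading a `Step0 3` chain `c` with `ordZero (c k).F = 3`: every ambient is REGULAR, every marked ideal
is an EFFECTIVE CARTIER divisor, its ORDER at the marked point equals the multiplicity `3`, and the marked point is NOT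
OPEN.  Proof:

* the two chart-local conjuncts hold at ANY stage (`GStage.idealOrder_M_x`, `GStage.not_isOpen_x`): read through the open
  chart `φ : 𝔸⁵ ↪ Z` centred at `x` with `M.ideal.comap φ = (z³ + F)·𝒪` (`idealOrder_comap_of_isOpenImmersion`,
  res-dim4-p-11 g2's `idealOrder_hypSheaf_ξ` / `not_isOpen_singleton_ξ`);
* regularity and Cartier-ness by induction along the tower (`GStage.next_isRegular`, `GStage.next_isEffectiveCartier`):
  base `𝔸⁵` regular and `(z³ + F)·𝒪` effective Cartier (res-dim4-p-11 g2's `isRegular_P`,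
  `isEffectiveCartier_hypSheaf_three`); step = Liu 8.1.19 (a) (tree `IsBlowup.isRegular_of_isRegular_subscheme` at the
  reduced closed point, `isRegular_subscheme_vanishingIdeal_singleton`) and Kollár 3.30.2 (tree
  `IsBlowup.isEffectiveCartier_controlledTransform_of_le_pow`, the weight condition `M.ideal ≤ 𝓘_x^3` from the order by
  res-dim4-p-11 g2's `le_vanishingIdeal_singleton_pow_of_le_idealOrder`).

Consequence: `towerInvariants : TowerInvariants`; with `modelRow_of_towerInvariants` (p668106) the term
`modelRow_of_towerInvariants towerInvariants : ModelRow` is a second, independent proof of row (M) next to the landed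
`E2OfCJS.modelRow` (res-dim4-p-2 g2, `…E2OfCJSFinal`, via res-dim4-p-11 g2's `strictTransformBlowup` ∘
`localizationRow_of_strictTransform`) — not re-declared here (same statement).

bears_on: LADDER-RESOLUTION:D157-DOOR2 (res-dim4-pi · F4-I(3,3) · CJS dictionary · row M, route B).  Supports
stmt-ResolutionOfSingularities-16155 (helper).
-/

set_option linter.dupNamespace false -- mandated namespace of this single-conjunct summit

noncomputable section

open CategoryTheory AlgebraicGeometry TopologicalSpace
open Literature.AlgebraicGeometry.Resolution
open Literature.AlgebraicGeometry.Resolution.Hauser2010 (ordZero)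
open Literature.AlgebraicGeometry.Resolution.AffinePointBlowup (P A ξ)
open Scheme.IdealSheafData

namespace Summit.ResolutionOfSingularities.ResolutionOfSingularities.Theorems.PIDim4

namespace E2OfCJS

namespace GStage

variable {K : Type} [Field K]

/-! ## §1 The chart-local invariants of a stage -/

/-- **The order of the marked ideal at the marked point is the multiplicity `3`**, read through the chart
(`ord_x M = ord_ξ (z³ + F)·𝒪 = 3` for `ordZero F = 3`). [cite: BierstoneGrigorievMilmanWlodarczyk2011, Lemma 8.0.3 (2)] -/
theorem idealOrder_M_x {F : MvPolynomial (Fin 4) K} (G : GStage K F) (hF : ordZero F = (3 : ℕ∞)) :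
    idealOrder G.M.ideal G.x = G.M.mult := by
  haveI := G.oi
  rw [G.hmult, ← G.hφ, ← idealOrder_comap_of_isOpenImmersion G.φ G.M.ideal (ξ 4 K), G.hM]
  exact StrictTransform.idealOrder_hypSheaf_ξ (p := 3) (by norm_num) F (by exact_mod_cast hF)

/-- The weight condition: **`M.ideal ≤ 𝓘_x^{mult}`** (order `3 = mult` at the closed point `x`).
[cite: BierstoneGrigorievMilmanWlodarczyk2011, Lemma 3.2.1 (1)] -/
theorem ideal_le_centre_pow {F : MvPolynomial (Fin 4) K} (G : GStage K F) (hF : ordZero F = (3 : ℕ∞)) :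
    G.M.ideal ≤ G.centre ^ G.M.mult :=
  StrictTransform.le_vanishingIdeal_singleton_pow_of_le_idealOrder G.M.ideal G.hx (G.idealOrder_M_x hF).ge

/-- **The marked point is not open**: its preimage under the injective open chart is `{ξ}`, which is not open in `𝔸⁵`.
[folklore] -/
theorem not_isOpen_x {F : MvPolynomial (Fin 4) K} (G : GStage K F) : ¬ IsOpen ({G.x} : Set G.Z) := by
  haveI := G.oi
  intro h
  have hpre : (G.φ : P 4 K → G.Z) ⁻¹' {G.x} = {ξ 4 K} := by
    ext y
    simp only [Set.mem_preimage, Set.mem_singleton_iff]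
    refine ⟨fun hy => G.φ.isOpenEmbedding.injective (hy.trans G.hφ.symm), ?_⟩
    rintro rfl
    exact G.hφ
  exact StrictTransform.not_isOpen_singleton_ξ (K := K) (hpre ▸ h.preimage G.φ.continuous)

/-! ## §2 Regularity and Cartier-ness propagate to the next stage -/

section Next

variable [CharP K 3] [PerfectRing K 3] [DecidableEq K]

/-- **The next ambient is regular** if the current one is: the blow-up of a regular locally Noetherian scheme at a
reduced closed point (a regular centre) is regular. [cite: Liu2002, Thm. 8.1.19 (a)] -/
theorem next_isRegular {F : MvPolynomial (Fin 4) K} (G : GStage K F) (s : State K) (hs : s.F = F)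
    (hperm : ((3 : ℕ) : ℕ∞) ≤ CentreBlowup.ordAlong (Finset.univ : Finset (Fin 4)) s.F) (j : Fin 4)
    {b : Fin 4 → K} (hbj : b j = 0) (F' : MvPolynomial (Fin 4) K)
    (hF' : (CentreBlowup.step 3 Finset.univ j b s).F = F') (hZ : Scheme.IsRegular G.Z) :
    Scheme.IsRegular (G.next s hs hperm j hbj F' hF').Z := by
  haveI := G.ln
  rw [next_Z]
  exact (blowup.isBlowup G.centre).isRegular_of_isRegular_subscheme hZ
    (isRegular_subscheme_vanishingIdeal_singleton G.hx)

/-- **The next marked ideal is an effective Cartier divisor** if the current one is: it is the controlled transform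
with weight `mult = 3 ≤ ord_x`, a factor of the (effective Cartier) total transform. [cite: Kollar2007, 3.30.2] -/
theorem next_isEffectiveCartier {F : MvPolynomial (Fin 4) K} (G : GStage K F) (s : State K) (hs : s.F = F)
    (hperm : ((3 : ℕ) : ℕ∞) ≤ CentreBlowup.ordAlong (Finset.univ : Finset (Fin 4)) s.F) (j : Fin 4)
    {b : Fin 4 → K} (hbj : b j = 0) (F' : MvPolynomial (Fin 4) K)
    (hF' : (CentreBlowup.step 3 Finset.univ j b s).F = F') (hF : ordZero F = (3 : ℕ∞))
    (hM : IsEffectiveCartier G.M.ideal) :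
    IsEffectiveCartier (G.next s hs hperm j hbj F' hF').M.ideal := by
  rw [next_M, MarkedIdeal.transform_ideal]
  exact (blowup.isBlowup G.centre).isEffectiveCartier_controlledTransform_of_le_pow hM (G.ideal_le_centre_pow hF)

/-! ## §3 Along the tower -/

/-- **Every ambient of the tower is regular and every marked ideal is an effective Cartier divisor** (induction:
`𝔸⁵` regular with `(z³ + F)·𝒪` principal non-zero; §2 for the step). [cite: Liu2002, Thm. 8.1.19 (a)] -/
theorem tower_isRegular_and_isEffectiveCartier (c : ℕ → State K) (hc : ∀ k, Step0 3 (c k) (c (k + 1)))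
    (hord : ∀ k, ordZero (c k).F = (3 : ℕ∞)) :
    ∀ i, Scheme.IsRegular (tower c hc i).Z ∧ IsEffectiveCartier (tower c hc i).M.ideal
  | 0 =>
    ⟨show Scheme.IsRegular (P 4 K) from StrictTransform.isRegular_P,
      show IsEffectiveCartier (hypSheaf 3 (c 0).F) from StrictTransform.isEffectiveCartier_hypSheaf_three _⟩
  | i + 1 => by
    obtain ⟨hZ, hM⟩ := tower_isRegular_and_isEffectiveCartier c hc hord i
    exact ⟨next_isRegular (tower c hc i) (c i) rfl _ _ _ _ _ hZ,
      next_isEffectiveCartier (tower c hc i) (c i) rfl _ _ _ _ _ (hord i) hM⟩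

end Next

end GStage

/-! ## §4 `TowerInvariants` -/

/-- **`TowerInvariants` HOLDS**: along `GStage.tower c hc` (algebraically closed `K` of characteristic `3`, `Step0 3`
chain with `ordZero ≡ 3`) every ambient is regular, every marked ideal is effective Cartier of order `= mult` at the
marked point, and the marked point is not open.  Hence `modelRow_of_towerInvariants towerInvariants : ModelRow`
(route (B) of row (M); the landed name of that statement is `E2OfCJS.modelRow`, route (A)).
[OURS · route (B) of row (M)] [cite: Liu2002, Thm. 8.1.19 (a)] -/
theorem towerInvariants : TowerInvariants := by
  intro K _ _ _ _ c hc hord i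
  obtain ⟨hZ, hM⟩ := GStage.tower_isRegular_and_isEffectiveCartier c hc hord i
  exact ⟨hZ, hM, GStage.idealOrder_M_x _ (hord i), GStage.not_isOpen_x _⟩

end E2OfCJS

end Summit.ResolutionOfSingularities.ResolutionOfSingularities.Theorems.PIDim4
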